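import Literature.NumberTheory.IwasawaTheory.ClassicalMuVanishesQuadraticAscentShift
import Literature.NumberTheory.IwasawaTheory.ClassicalMuVanishesQuadraticAscentUnramified
import HarnessLib

/-!
# Iwasawa's `μ₂ = 0` along a quadratic extension with TOTALLY REAL top field, per layer, with NO hypothesis on `K ∩ ℚ_∞`, `K' ∩ ℚ_∞`
# (Iwasawa 1973 Thm. 2, nothing ramified at infinity; the totally-real twin of `ClassicalMuVanishesQuadraticAscentShift`; proved, no named fact)

`Proofs`-style file (theorems only, no `sorry`) in topic `NumberTheory/IwasawaTheory` (namespace `Literature.NumberTheory.IwasawaTheory`),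
written by the prover seat `bsd-line-att-p3` g36 (cell `bsd-f1-sign2`, route `AlignedTransportAtTwo`, `--supports` stmt-BirchSwinnertonDyer-22298;
closes nothing; nothing about elliptic curves or BSD is asserted).

`ClassicalMuVanishesQuadraticAscentShift` §3 bounds `rank₂ Cl(j'(K')·ℚ_m)` by `rank₂ Cl(j(K)·ℚ_m)` for EVERY layer `m` when `K'` is totally complex and
`K` has at most one real place (Chevalley's archimedean factor cancelled by the unit signatures of `ℚ_m`).  Here the other signature-free case:
`K'` TOTALLY REAL — then `B_m = j'(K')·ℚ_m` is totally real, `B_m/A_m` is unramified at infinity, the archimedean factor is `1`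
(`archFactor_eq_one`) and no unit datum enters (g34's `ClassicalMuVanishesQuadraticAscentUnramified`, per field).  Again `[B_m : A_m] ∈ {1,2}`
and no surjectivity of `κ ∘ res` is used, so the shifted towers of the sequel remove the «`√2 ∉ K'`» proviso from the totally-real ascents
of `ClassicalMuVanishesQuadraticAscentIntrinsic` / `ClassicalMuVanishesTwoPowerAscent`.

* §1 `padicValNat_card_quotient_le_of_quadratic_of_isUnramifiedAtInfinitePlaces` — pure number fields: `A ⊆ B`, `[B : A] = 2`, `B/A` unramified at
  the infinite places, `≤ T` ramified primes ⟹ `rank₂ Cl(B) ≤ 2·(2·rank₂ Cl(A) + T)`.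
* §2 `padicValNat_card_quotient_fieldRange_sup_layer_le_of_isTotallyReal` — the per-layer bound for `K' = K(x)` totally real, every `m`.
The assembled intrinsic step and the `2`-power ascent with totally real top are the sequel `ClassicalMuVanishesTwoPowerAscentRealFull`.

References: [Iwasawa1973MuInvariants] Thm. 2 and its proof (pp. 7–8), Thm. 3; [Washington1997] §13.1, §13.3 Prop. 13.23; [Lang1990] Ch. 13 §4
Lemma 4.1; [NeukirchANT1999] Ch. III (2.6), Ch. III §1 (1.6); [Childress2009] Ch. 4 §5 Prop. 5.10.
-/

set_option autoImplicit false

noncomputable section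

open scoped NumberField Classical
open NumberField NumberField.InfinitePlace Field IntermediateField IsDedekindDomain Module Polynomial

namespace Literature.NumberTheory.IwasawaTheory

open Literature.NumberTheory.EllipticCurves Literature.NumberTheory.EllipticCurves.ZpExtension
  Literature.NumberTheory.GaloisRepresentations Literature.NumberTheory.GaloisRepresentations.Herbrand
  Literature.NumberTheory.GaloisRepresentations.MinkowskiUnit Literature.NumberTheory.GaloisRepresentations.CyclicNormIndex
  Literature.NumberTheory.NumberFields
  Literature.NumberTheory.NumberFields.AmbiguousClass Literature.NumberTheory.NumberFields.CyclicRankBound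

/-! ## §1 The per-field `2`-rank bound, unramified at infinity -/

/-- `#(G / Gⁿ) = #(H / Hⁿ)` along a group isomorphism `G ≃* H`. [folklore] -/
private theorem natCard_quotient_range_powMonoidHom_eq_of_mulEquiv₄ {G H : Type*} [CommGroup G] [CommGroup H] (e : G ≃* H) (n : ℕ) :
    Nat.card (G ⧸ (powMonoidHom n : G →* G).range) = Nat.card (H ⧸ (powMonoidHom n : H →* H).range) := by
  have hmap : ((powMonoidHom n : G →* G).range).map e.toMonoidHom = (powMonoidHom n : H →* H).range := by
    ext h
    constructor
    · rintro ⟨g, ⟨x, rfl⟩, rfl⟩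
      exact ⟨e x, by rw [powMonoidHom_apply, powMonoidHom_apply, MulEquiv.coe_toMonoidHom, map_pow]⟩
    · rintro ⟨y, rfl⟩
      refine ⟨(e.symm y) ^ n, ⟨e.symm y, rfl⟩, ?_⟩
      rw [MulEquiv.coe_toMonoidHom, map_pow, MulEquiv.apply_symm_apply, powMonoidHom_apply]
  exact Nat.card_congr (QuotientGroup.congr _ _ e hmap).toEquiv

/-- **The `2`-rank bound along a quadratic extension unramified at the infinite places** (Chevalley with archimedean factor `1` + the ambiguous-class
rank lemma): `A ⊆ B` number fields, `[B : A] = 2`, `B/A` unramified at infinity (e.g. `B` totally real), at most `T` primes of `A` ramified in `B` ⟹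
`rank₂ Cl(B) ≤ 2·(2·rank₂ Cl(A) + T)`.  Assembled exactly as inside g34's `classicalMuVanishes_restrict_of_quadratic_of_isUnramifiedAtInfinitePlaces`.
[cite: Iwasawa1973MuInvariants, Thm. 2 (structure of the argument)] [cite: Lang1990, Ch. 13 §4 Lemma 4.1] [cite: Childress2009, Ch. 4 §5 Prop. 5.10] -/
theorem padicValNat_card_quotient_le_of_quadratic_of_isUnramifiedAtInfinitePlaces (A B : Type) [Field A] [NumberField A] [Field B]
    [NumberField B] [Algebra A B] [IsUnramifiedAtInfinitePlaces A B] (hdeg : Module.finrank A B = 2) (T : ℕ)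
    (hram : {v : HeightOneSpectrum (𝓞 A) | v.asIdeal.ramificationIdxIn (𝓞 B) ≠ 1}.ncard ≤ T) :
    padicValNat 2 (Nat.card (ClassGroup (𝓞 B) ⧸ (powMonoidHom 2 : ClassGroup (𝓞 B) →* _).range)) ≤
      2 * (2 * padicValNat 2 (Nat.card (ClassGroup (𝓞 A) ⧸ (powMonoidHom 2 : ClassGroup (𝓞 A) →* _).range)) + T) := by
  haveI : Fact (Nat.Prime 2) := ⟨Nat.prime_two⟩
  haveI : Algebra.IsQuadraticExtension A B := ⟨hdeg⟩
  haveI : IsGalois A B := inferInstance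
  haveI : FiniteDimensional A B := Module.finite_of_finrank_eq_succ hdeg
  obtain ⟨σ, hσ⟩ := IsCyclic.exists_generator (α := B ≃ₐ[A] B)
  have hcard : Fintype.card (B ≃ₐ[A] B) = 2 := by
    rw [← Nat.card_eq_fintype_card, IsGalois.card_aut_eq_finrank, hdeg]
  have hσ2 : σ * σ = 1 := by rw [← pow_two, ← hcard, pow_card_eq_one]
  -- module (L): Chevalley with archimedean factor `1`
  have harch : padicValNat 2 (ArchHerbrand.archFactor A B) ≤
      padicValNat 2 ((unitsE B ⊓ (⊤ : Subgroup Bˣ).map (Herbrand.norm (B ≃ₐ[A] B))).relIndex (unitsE B ⊓ (unitsIncl A B).range)) := by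
    rw [archFactor_eq_one, padicValNat_one_right]
    exact Nat.zero_le _
  have hchev := padicValNat_card_fixed_add_one_le_of_archFactor (K := A) (L := B) Nat.prime_two hdeg hσ harch
  -- the action on `Cl(B)` and its fixed classes
  set f : ClassGroup (𝓞 B) ≃* ClassGroup (𝓞 B) := ClassGroup.mulEquiv (intAut σ) with hf
  have hfixed : Nat.card {c : ClassGroup (𝓞 B) // ∀ τ : B ≃ₐ[A] B, ClassGroup.mulEquiv (intAut τ) c = c} =
      Nat.card (f.toMonoidHom.eqLocus (MonoidHom.id _)) :=
    natCard_fixed_eq_natCard_eqLocus_of_generator (fun τ : B ≃ₐ[A] B ↦ ClassGroup.mulEquiv (intAut τ))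
      mulEquiv_intAut_one mulEquiv_intAut_mul hσ
  have hff : ∀ b : ClassGroup (𝓞 B), (⇑f.toMonoidHom)^[2] b = b := fun b ↦ by
    rw [Function.iterate_succ_apply, Function.iterate_one, MulEquiv.coe_toMonoidHom, hf, ← MulEquiv.trans_apply,
      ← mulEquiv_intAut_mul, hσ2, mulEquiv_intAut_one, MulEquiv.refl_apply]
  -- module (G): the rank bound
  have hNj : ∀ a : ClassGroup (𝓞 A), classGroupNorm A B (classGroupExtend A B a) = a ^ 2 := fun a ↦ by
    rw [classGroupNorm_classGroupExtend, hdeg]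
  have hjfix : ∀ a : ClassGroup (𝓞 A), f.toMonoidHom (classGroupExtend A B a) = classGroupExtend A B a := fun a ↦ by
    rw [MulEquiv.coe_toMonoidHom, hf, mulEquiv_intAut_classGroupExtend]
  have hfix : padicValNat 2 (Nat.card (f.toMonoidHom.eqLocus (MonoidHom.id _))) ≤
      padicValNat 2 (Nat.card (ClassGroup (𝓞 A))) + T := by
    rw [← hfixed]
    have hcl : classNumber A = Nat.card (ClassGroup (𝓞 A)) := by
      rw [classNumber, Nat.card_eq_fintype_card]
    rw [← hcl]
    omega
  exact padicValNat_card_quotient_le_of_fixed 2 f.toMonoidHom hff (classGroupExtend A B) (classGroupNorm A B) hNj hjfix T hfix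

/-! ## §2 The per-layer bound for `A_m = j(K)·ℚ_m ⊆ B_m = j'(K')·ℚ_m` with `K'` totally real, every `m` -/

/-- An integral element of `K'` gives an integral element of a subfield of `ℚ̄` containing its image. [folklore] -/
private theorem isIntegral_mk_of_isIntegral₄ {L : IntermediateField ℚ (AlgebraicClosure ℚ)} {y : AlgebraicClosure ℚ} (hy : y ∈ L)
    (hint : IsIntegral ℤ y) : IsIntegral ℤ (⟨y, hy⟩ : ↥L) :=
  (isIntegral_algHom_iff (IsScalarTower.toAlgHom ℤ ↥L (AlgebraicClosure ℚ)) Subtype.val_injective).mp hint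

variable (κ : ZpExtension ℚ 2)

set_option maxHeartbeats 800000 in
set_option synthInstance.maxHeartbeats 200000 in
/-- **The per-layer `2`-rank bound with TOTALLY REAL top field, no surjectivity anywhere** (Iwasawa 1973 Thm. 2: nothing ramifies at infinity).
`κ` the cyclotomic `ℤ₂`-extension of `ℚ` (layers `ℚ_m`, totally real); `K ⊆ K'` number fields with `K' = K(x)`, `x ∈ 𝓞_{K'}`, `x² = m₀ ∈ 𝓞_K ∖ 0`
(so `[K' : K] ≤ 2`), `K'` TOTALLY REAL; `j' : K' → ℚ̄`, `j = j'|_K`, `A_m = j(K)·ℚ_m ⊆ B_m = j'(K')·ℚ_m` (both totally real).  Then for EVERY `m`: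
`rank₂ Cl(B_m) ≤ 2·(2·rank₂ Cl(A_m) + T)`, `T = ∑_{ℓ ∣ N(4m₀)} [K:ℚ]·ℓ²`.  Degree `1`: `B_m = A_m`; degree `2`: §1 (archimedean factor `1`) and the
ramified primes above the prime factors of `N(4m₀)`, at most `[A_m : ℚ_m]·ℓ² ≤ [K:ℚ]·ℓ²` over each `ℓ`.
[cite: Iwasawa1973MuInvariants, Thm. 2 and its proof (pp. 7–8)] [cite: Washington1997, §13.1 and §13.3 Prop. 13.23] [cite: NeukirchANT1999, Ch. III (2.6)] -/
theorem padicValNat_card_quotient_fieldRange_sup_layer_le_of_isTotallyReal (hκ : κ.IsCyclotomic)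
    (K K' : Type) [Field K] [NumberField K] [Field K'] [NumberField K'] [Algebra K K'] [IsTotallyReal K']
    {x : 𝓞 K'} {m₀ : 𝓞 K} (hm : m₀ ≠ 0) (hx : x ^ 2 = algebraMap (𝓞 K) (𝓞 K') m₀) (hgen : Algebra.adjoin K {(x : K')} = ⊤)
    (j' : K' →ₐ[ℚ] AlgebraicClosure ℚ) (m : ℕ) :
    haveI : IsScalarTower ℚ K K' := IsScalarTower.of_algebraMap_eq' (Subsingleton.elim _ _)
    padicValNat 2 (Nat.card (ClassGroup (𝓞 ↥(j'.fieldRange ⊔ κ.layer m)) ⧸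
        (powMonoidHom 2 : ClassGroup (𝓞 ↥(j'.fieldRange ⊔ κ.layer m)) →* _).range)) ≤
      2 * (2 * padicValNat 2 (Nat.card (ClassGroup (𝓞 ↥((j'.comp (IsScalarTower.toAlgHom ℚ K K')).fieldRange ⊔ κ.layer m)) ⧸
        (powMonoidHom 2 : ClassGroup (𝓞 ↥((j'.comp (IsScalarTower.toAlgHom ℚ K K')).fieldRange ⊔ κ.layer m)) →* _).range)) +
        ∑ ℓ ∈ ((Ideal.absNorm (Ideal.span {(4 * m₀ : 𝓞 K)}) : ℤ)).natAbs.primeFactors, Module.finrank ℚ K * ℓ ^ 2) := by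
  haveI : Fact (Nat.Prime 2) := ⟨Nat.prime_two⟩
  haveI : IsScalarTower ℚ K K' := IsScalarTower.of_algebraMap_eq' (Subsingleton.elim _ _)
  haveI : FiniteDimensional K K' := Module.Finite.of_restrictScalars_finite ℚ K K'
  set j : K →ₐ[ℚ] AlgebraicClosure ℚ := j'.comp (IsScalarTower.toAlgHom ℚ K K') with hj
  -- the integer `N₀ = N(4m₀)` whose prime factors control the ramified primes of every layer
  set N₀ : ℕ := Ideal.absNorm (Ideal.span {(4 * m₀ : 𝓞 K)}) with hN₀
  have h4m0 : (4 * m₀ : 𝓞 K) ≠ 0 := mul_ne_zero (by norm_num) hm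
  have hN₀0 : (N₀ : ℤ) ≠ 0 := by
    rw [hN₀]
    exact_mod_cast (Ideal.absNorm_eq_zero_iff.not.mpr (mt Ideal.span_singleton_eq_bot.mp h4m0))
  have hdvdK : (4 * m₀ : 𝓞 K) ∣ ((N₀ : ℤ) : 𝓞 K) := by
    rw [← Ideal.mem_span_singleton]
    have h := Ideal.absNorm_mem (Ideal.span {(4 * m₀ : 𝓞 K)})
    rw [← hN₀] at h
    exact_mod_cast h
  set T : ℕ := ∑ ℓ ∈ (N₀ : ℤ).natAbs.primeFactors, Module.finrank ℚ K * ℓ ^ 2 with hT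
  -- the layer `A = j(K)·ℚ_m ⊆ B = j'(K')·ℚ_m`
  set L : IntermediateField ℚ (AlgebraicClosure ℚ) := κ.layer m with hL
  set A : IntermediateField ℚ (AlgebraicClosure ℚ) := j.fieldRange ⊔ L with hA
  set B : IntermediateField ℚ (AlgebraicClosure ℚ) := j'.fieldRange ⊔ L with hB
  have hAB : A ≤ B := fieldRange_comp_sup_layer_le κ K K' j' m
  haveI : NumberField ↥A := numberField_fieldRange_sup_layer κ K j m
  haveI : NumberField ↥B := numberField_fieldRange_sup_layer κ K' j' m
  letI : Algebra ↥A ↥B := (IntermediateField.inclusion hAB).toRingHom.toAlgebra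
  haveI : IsScalarTower ℚ ↥A ↥B := IsScalarTower.of_algebraMap_eq fun _ ↦ rfl
  haveI : Module.Free ↥A ↥B := Module.Free.of_divisionRing ↥A ↥B
  haveI : FiniteDimensional ↥A ↥B := Module.Finite.of_restrictScalars_finite ℚ ↥A ↥B
  haveI : FiniteDimensional ℚ ↥L := κ.finiteDimensional_layer_holds m
  haveI : NumberField ↥L := NumberField.of_module_finite ℚ _
  haveI : FiniteDimensional ℚ ↥j.fieldRange := (AlgEquiv.ofInjectiveField j).toLinearEquiv.finiteDimensional
  -- `B` is totally real (compositum of the totally real `j'(K')` and `ℚ_m`), so `B/A` is unramified at infinity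
  haveI : IsTotallyReal ↥B := isTotallyReal_fieldRange_sup_layer κ K' j' m
  haveI : IsUnramifiedAtInfinitePlaces ↥A ↥B := isUnramifiedAtInfinitePlaces_of_isTotallyReal ↥A ↥B
  -- the generator in the layer: `x_B² = m_A`, `B = A(x_B)`
  have hjA : j.fieldRange ≤ A := le_sup_left
  have hj'B : j'.fieldRange ≤ B := le_sup_left
  have hLA : L ≤ A := le_sup_right
  have hmA : (j ((m₀ : 𝓞 K) : K)) ∈ A := hjA ⟨(m₀ : K), rfl⟩
  have hxB : (j' ((x : 𝓞 K') : K')) ∈ B := hj'B ⟨(x : K'), rfl⟩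
  let mA : 𝓞 ↥A := ⟨⟨j ((m₀ : 𝓞 K) : K), hmA⟩, isIntegral_mk_of_isIntegral₄ hmA (map_isIntegral_int j m₀.isIntegral_coe)⟩
  let xB : 𝓞 ↥B := ⟨⟨j' ((x : 𝓞 K') : K'), hxB⟩, isIntegral_mk_of_isIntegral₄ hxB (map_isIntegral_int j' x.isIntegral_coe)⟩
  have hjm : j ((m₀ : 𝓞 K) : K) = j' (algebraMap K K' ((m₀ : 𝓞 K) : K)) := rfl
  have hx' : ((x : 𝓞 K') : K') ^ 2 = algebraMap K K' ((m₀ : 𝓞 K) : K) := by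
    have h := congrArg (fun z : 𝓞 K' ↦ (z : K')) hx
    have e1 : (((x ^ 2 : 𝓞 K') : 𝓞 K') : K') = ((x : 𝓞 K') : K') ^ 2 := by push_cast; rfl
    have e2 : (((algebraMap (𝓞 K) (𝓞 K') m₀ : 𝓞 K') : 𝓞 K') : K') = algebraMap K K' ((m₀ : 𝓞 K) : K) := rfl
    rw [← e1, ← e2]
    exact h
  have hxB2 : xB ^ 2 = algebraMap (𝓞 ↥A) (𝓞 ↥B) mA := by
    apply RingOfIntegers.ext
    apply Subtype.ext
    change (j' ((x : 𝓞 K') : K')) ^ 2 = j ((m₀ : 𝓞 K) : K)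
    rw [← map_pow, hx', hjm]
  have hxB2' : ((xB : 𝓞 ↥B) : ↥B) ^ 2 = algebraMap ↥A ↥B ((mA : 𝓞 ↥A) : ↥A) := by
    apply Subtype.ext
    change (j' ((x : 𝓞 K') : K')) ^ 2 = j ((m₀ : 𝓞 K) : K)
    rw [← map_pow, hx', hjm]
  -- `B = A(x_B)`
  have hgenB : Algebra.adjoin ↥A {((xB : 𝓞 ↥B) : ↥B)} = ⊤ := by
    set Tad : Subalgebra ↥A ↥B := Algebra.adjoin ↥A {((xB : 𝓞 ↥B) : ↥B)} with hTad
    -- the elements of `ℚ̄` lying in `B` whose class is in `Tad`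
    let S : Subalgebra ℚ (AlgebraicClosure ℚ) :=
      { carrier := {y | ∃ hy : y ∈ B, (⟨y, hy⟩ : ↥B) ∈ Tad}
        mul_mem' := by
          rintro a b ⟨ha, ha'⟩ ⟨hb, hb'⟩
          exact ⟨mul_mem ha hb, by
            have e : (⟨a * b, mul_mem ha hb⟩ : ↥B) = ⟨a, ha⟩ * ⟨b, hb⟩ := rfl
            rw [e]; exact Tad.mul_mem ha' hb'⟩
        one_mem' := ⟨one_mem _, by
          have e : (⟨1, one_mem _⟩ : ↥B) = 1 := rfl
          rw [e]; exact Tad.one_mem⟩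
        add_mem' := by
          rintro a b ⟨ha, ha'⟩ ⟨hb, hb'⟩
          exact ⟨add_mem ha hb, by
            have e : (⟨a + b, add_mem ha hb⟩ : ↥B) = ⟨a, ha⟩ + ⟨b, hb⟩ := rfl
            rw [e]; exact Tad.add_mem ha' hb'⟩
        zero_mem' := ⟨zero_mem _, by
          have e : (⟨0, zero_mem _⟩ : ↥B) = 0 := rfl
          rw [e]; exact Tad.zero_mem⟩
        algebraMap_mem' := fun r ↦ ⟨IntermediateField.algebraMap_mem B r, Tad.algebraMap_mem (algebraMap ℚ ↥A r)⟩ }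
    -- `A ⊆ S`
    have hAS : ∀ y (hy : y ∈ A), y ∈ S := fun y hy ↦ ⟨hAB hy, by
      have e : (⟨y, hAB hy⟩ : ↥B) = algebraMap ↥A ↥B ⟨y, hy⟩ := rfl
      rw [e]; exact Tad.algebraMap_mem _⟩
    -- `j'(K') ⊆ S`: every element of `K'` is a polynomial in `x` over `K`
    have hK'S : j'.fieldRange.toSubalgebra ≤ S := by
      rintro _ ⟨y, rfl⟩
      have hy : (y : K') ∈ Algebra.adjoin K {((x : 𝓞 K') : K')} := by rw [hgen]; exact Algebra.mem_top
      induction hy using Algebra.adjoin_induction with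
      | mem z hz =>
        rw [Set.mem_singleton_iff] at hz
        subst hz
        exact ⟨hxB, Algebra.subset_adjoin (Set.mem_singleton _)⟩
      | algebraMap r =>
        have : j' (algebraMap K K' r) = j r := rfl
        rw [AlgHom.toRingHom_eq_coe, RingHom.coe_coe, this]
        exact hAS _ (hjA ⟨r, rfl⟩)
      | add a b _ _ ha hb =>
        rw [AlgHom.toRingHom_eq_coe, RingHom.coe_coe, map_add]
        exact S.add_mem ha hb
      | mul a b _ _ ha hb =>
        rw [AlgHom.toRingHom_eq_coe, RingHom.coe_coe, map_mul]
        exact S.mul_mem ha hb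
    have hLS : L.toSubalgebra ≤ S := fun y hy ↦ hAS y (hLA hy)
    have hBS : B.toSubalgebra ≤ S := by
      haveI : Algebra.IsAlgebraic ℚ ↥L := Algebra.IsAlgebraic.of_finite ℚ ↥L
      rw [hB, IntermediateField.sup_toSubalgebra_of_isAlgebraic_right]
      exact sup_le hK'S hLS
    rw [eq_top_iff]
    rintro ⟨y, hy⟩ -
    obtain ⟨hy', h⟩ := hBS hy
    exact h
  -- hence `[B : A] ≤ 2`
  have hxint : IsIntegral ↥A ((xB : 𝓞 ↥B) : ↥B) := IsIntegral.of_finite _ _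
  have hdegle : Module.finrank ↥A ↥B ≤ 2 := by
    have h1 : Module.finrank ↥A ↥(↥A)⟮((xB : 𝓞 ↥B) : ↥B)⟯ = (minpoly ↥A ((xB : 𝓞 ↥B) : ↥B)).natDegree :=
      IntermediateField.adjoin.finrank hxint
    have htop : (↥A)⟮((xB : 𝓞 ↥B) : ↥B)⟯ = ⊤ := by
      apply IntermediateField.toSubalgebra_injective
      rw [IntermediateField.adjoin_simple_toSubalgebra_of_isAlgebraic hxint.isAlgebraic, hgenB, IntermediateField.top_toSubalgebra]
    have hne : (X ^ 2 - C ((mA : 𝓞 ↥A) : ↥A) : (↥A)[X]) ≠ 0 := (monic_X_pow_sub_C _ two_ne_zero).ne_zero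
    have hroot : aeval ((xB : 𝓞 ↥B) : ↥B) (X ^ 2 - C ((mA : 𝓞 ↥A) : ↥A) : (↥A)[X]) = 0 := by
      rw [map_sub, aeval_X_pow, aeval_C, hxB2', sub_self]
    have h2 : (minpoly ↥A ((xB : 𝓞 ↥B) : ↥B)).natDegree ≤ 2 := by
      calc (minpoly ↥A ((xB : 𝓞 ↥B) : ↥B)).natDegree ≤ (X ^ 2 - C ((mA : 𝓞 ↥A) : ↥A) : (↥A)[X]).natDegree :=
            natDegree_le_of_dvd (minpoly.dvd _ _ hroot) hne
        _ = 2 := natDegree_X_pow_sub_C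
    rw [← IntermediateField.finrank_top', ← htop, h1]
    exact h2
  have hdegpos : 0 < Module.finrank ↥A ↥B := Module.finrank_pos
  -- abbreviations for the two ranks
  set rA : ℕ := padicValNat 2 (Nat.card (ClassGroup (𝓞 ↥A) ⧸ (powMonoidHom 2 : ClassGroup (𝓞 ↥A) →* _).range)) with hrA
  set rB : ℕ := padicValNat 2 (Nat.card (ClassGroup (𝓞 ↥B) ⧸ (powMonoidHom 2 : ClassGroup (𝓞 ↥B) →* _).range)) with hrB
  change rB ≤ 2 * (2 * rA + T)
  rcases Nat.lt_or_ge (Module.finrank ↥A ↥B) 2 with hlt | hge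
  · -- degree `1`: `B = A`
    have hdeg1 : Module.finrank ↥A ↥B = 1 := by omega
    have hfin : Module.finrank ℚ ↥A = Module.finrank ℚ ↥B := by
      have htower := Module.finrank_mul_finrank ℚ ↥A ↥B
      rw [hdeg1, mul_one] at htower
      exact htower
    have hEq : A = B := IntermediateField.eq_of_le_of_finrank_eq hAB hfin
    have hrAB : rA = rB := by
      rw [hrA, hrB]
      exact congrArg (padicValNat 2) (natCard_quotient_range_powMonoidHom_eq_of_mulEquiv₄
        (ClassGroup.mulEquiv (NumberField.RingOfIntegers.mapRingEquiv (IntermediateField.equivOfEq hEq).toRingEquiv)) 2)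
    omega
  · -- degree `2`: Chevalley
    have hdegAB : Module.finrank ↥A ↥B = 2 := le_antisymm hdegle hge
    haveI : Algebra.IsQuadraticExtension ↥A ↥B := ⟨hdegAB⟩
    haveI : IsGalois ↥A ↥B := inferInstance
    -- count: ramified primes contain `4 m_A`, which divides `N₀`
    have hmA0 : mA ≠ 0 := by
      intro h0
      apply hm
      have h1 : ((mA : 𝓞 ↥A) : ↥A) = 0 := by rw [h0]; rfl
      have h2 : j ((m₀ : 𝓞 K) : K) = 0 := by
        have := congrArg Subtype.val h1
        rwa [ZeroMemClass.coe_zero] at this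
      rw [map_eq_zero_iff j j.injective] at h2
      exact RingOfIntegers.ext (by simpa using h2)
    let ψ : 𝓞 K →+* 𝓞 ↥A :=
      { toFun := fun k ↦ ⟨⟨j ((k : 𝓞 K) : K), hjA ⟨(k : K), rfl⟩⟩,
          isIntegral_mk_of_isIntegral₄ _ (map_isIntegral_int j k.isIntegral_coe)⟩
        map_one' := by apply RingOfIntegers.ext; apply Subtype.ext; simp
        map_mul' := fun a b ↦ by apply RingOfIntegers.ext; apply Subtype.ext; simp
        map_zero' := by apply RingOfIntegers.ext; apply Subtype.ext; simp
        map_add' := fun a b ↦ by apply RingOfIntegers.ext; apply Subtype.ext; simp }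
    have hψm : ψ m₀ = mA := rfl
    have hdvdA : (4 * mA : 𝓞 ↥A) ∣ (((N₀ : ℤ) : 𝓞 ↥A)) := by
      have h := map_dvd ψ hdvdK
      rw [map_mul, hψm, map_intCast] at h
      have e4 : ψ 4 = 4 := by rw [show (4 : 𝓞 K) = ((4 : ℤ) : 𝓞 K) by norm_cast, map_intCast]; norm_cast
      rwa [e4] at h
    have hram1 := ncard_ramified_le_ncard_mem hxB2 hgenB hmA0
    have hram2 := ncard_setOf_mem_le_sum_primesOver (F := ↥A) hN₀0 hdvdA
    -- primes of `A` over `ℓ`: at most `[A : ℚ_m]·ℓ² ≤ [K : ℚ]·ℓ²`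
    letI : Algebra ↥L ↥A := (IntermediateField.inclusion hLA).toRingHom.toAlgebra
    haveI : IsScalarTower ℚ ↥L ↥A := IsScalarTower.of_algebraMap_eq fun _ ↦ rfl
    haveI : Module.Free ↥L ↥A := Module.Free.of_divisionRing ↥L ↥A
    haveI : FiniteDimensional ↥L ↥A := Module.Finite.of_restrictScalars_finite ℚ ↥L ↥A
    have hdegLA : Module.finrank ↥L ↥A ≤ Module.finrank ℚ K := by
      have htower := Module.finrank_mul_finrank ℚ ↥L ↥A
      have hsup : Module.finrank ℚ ↥A ≤ Module.finrank ℚ ↥j.fieldRange * Module.finrank ℚ ↥L :=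
        IntermediateField.finrank_sup_le j.fieldRange L
      have hjK : Module.finrank ℚ ↥j.fieldRange = Module.finrank ℚ K :=
        (AlgEquiv.ofInjectiveField j).toLinearEquiv.finrank_eq.symm
      have hLpos : 0 < Module.finrank ℚ ↥L := Module.finrank_pos
      rw [hjK, ← htower, mul_comm (Module.finrank ℚ K)] at hsup
      exact Nat.le_of_mul_le_mul_left hsup hLpos
    have hfib : ∀ ℓ ∈ (N₀ : ℤ).natAbs.primeFactors,
        ((Ideal.span {(ℓ : ℤ)}).primesOver (𝓞 ↥A)).ncard ≤ Module.finrank ℚ K * ℓ ^ 2 := fun ℓ hℓ ↦ by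
      have hℓp : ℓ.Prime := Nat.prime_of_mem_primeFactors hℓ
      refine (ncard_primesOver_le_finrank_mul ↥L ↥A hℓp).trans ?_
      exact Nat.mul_le_mul hdegLA (ncard_primesOver_layer_two_le_sq hκ m hℓp)
    have hramT : {v : HeightOneSpectrum (𝓞 ↥A) | v.asIdeal.ramificationIdxIn (𝓞 ↥B) ≠ 1}.ncard ≤ T :=
      calc {v : HeightOneSpectrum (𝓞 ↥A) | v.asIdeal.ramificationIdxIn (𝓞 ↥B) ≠ 1}.ncard
          ≤ {v : HeightOneSpectrum (𝓞 ↥A) | 4 * mA ∈ v.asIdeal}.ncard := hram1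
        _ ≤ ∑ ℓ ∈ (N₀ : ℤ).natAbs.primeFactors, ((Ideal.span {(ℓ : ℤ)}).primesOver (𝓞 ↥A)).ncard := hram2
        _ ≤ T := Finset.sum_le_sum hfib
    exact padicValNat_card_quotient_le_of_quadratic_of_isUnramifiedAtInfinitePlaces ↥A ↥B hdegAB T hramT

end Literature.NumberTheory.IwasawaTheory

end
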